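import Literature.Probability.RandomPlanarGeometry.SelfAvoidingWalk
import Literature.Probability.RandomPlanarGeometry.SupercriticalSAWPolygons
import Mathlib.Probability.ConditionalProbability
import HarnessLib

/-!
# The frontier-tilted family of SAW measures `P^{(s,x)} ∝ x^{|γ|} B(γ)^s`

Topic `Literature/Probability/RandomPlanarGeometry`, next to `SelfAvoidingWalk.lean` (whose
`SAW.DomainSAW Ω δ a b`, `SAW.weight`, `SAW.law`, `SAW.criticalFugacity = x_c` are used).
Notion `FrontierTiltedSAWLaw`, requested by route `SAWFrontierHomotopy` of
`Summits/CriticalPhenomena/SAWScalingLimit` (crux `OneSidedContinuation`; idea card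
`Ideas/_closed/drain-the-lakes-one-sided-homotopy.md`). This is a NEW OBJECT posited for that
route, not a published definition: the one-parameter *tilt homotopy* from the law of the right
frontier of the random-walk excursion (`s = 1`) to the critical self-avoiding walk (`s = 0`),
the one-sided analogue of the Kozdron–Lawler `λ`-SAW (which tilts the SAW weights `e^{-r|ω|}` by
`e^{λ m*(A; ω)}`, the random-walk loop measure of the loops hitting `ω`, a TWO-sided functional,
with a critical `r_λ` "such that the total mass neither decays nor grows exponentially",
`e^{-r_1} = 1/4`, `e^{r_0} =` the connective constant [cite: KozdronLawler2007, §6]); the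
continuum picture is the one-sided ("right-sided") restriction property of
[cite: LawlerSchrammWerner2003Restriction, §8.1 and Cor. 8.5].

## Contents (namespace `Literature.Probability.RandomPlanarGeometry.SAW`)

* `tiltedWeight B s x` — for a weight `B : DomainSAW Ω δ a b → ℝ≥0∞` ("frontier weight") and
  parameters `s x : ℝ`, the measure `W^{(s,x)}(γ) = x^{|γ|} B(γ)^s` on `DomainSAW Ω δ a b` (a
  `Measure.sum` of weighted Dirac masses, exactly like `SAW.weight`), and its normalisation
  `tiltedLaw B s x = P^{(s,x)} = W^{(s,x)} / W^{(s,x)}(univ)` (junk `0` if the mass is `0` or `∞`,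
  like `SAW.law`); `tiltedLaw_eq_zero_or_isProbabilityMeasure`.
* **`s = 0` is the critical SAW** (PROVED, for every `B`): `tiltedWeight_zero_criticalFugacity :
  tiltedWeight B 0 x_c = SAW.weight Ω δ a b`, `tiltedLaw_zero_criticalFugacity :
  tiltedLaw B 0 x_c = SAW.law Ω δ a b` (`B^0 = 1`, also for `B = 0` or `∞`: `ENNReal.rpow_zero`).
* `FrontierModel Ω δ a b` — the datum the request presupposes from the companion notion
  `RightFrontierSAW` (work item `defn-RightFrontierSAW`, not yet in the tree): a type of lattice
  paths `ω` (the nearest-neighbour face-walks of `Ω_δ` from the face at `a` to the face at `b`)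
  with a length `len ω` and a frontier map `frontier ω : DomainSAW Ω δ a b` (the right frontier of
  the pinch-filled trace). From it: the path weight `4^{-|ω|}` (`pathWeight`), the **frontier
  measure** `frontierLaw = frontier_* (∑_ω 4^{-|ω|} δ_ω)` (the law of the right frontier of the
  random-walk excursion, un-normalised; its mass `frontierLaw univ` is the excursion mass), the
  **frontier weight** `frontierWeight γ = B(γ) = 4^{|γ|} · ∑_{frontier ω = γ} 4^{-|ω|}`
  (`frontierWeight_eq`), and the tilted family `M.tiltedWeight s x`, `M.tiltedLaw s x` of the
  model. Instantiating `FrontierModel` with the face-walks and `rightFrontier` of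
  `RightFrontierSAW` (one line) yields the requested `ℤ²` object; every statement below is proved
  for all models.
* **`s = 1`, `x = 1/4` is the frontier law** (PROVED): `FrontierModel.tiltedWeight_one_quarter :
  M.tiltedWeight 1 4⁻¹ = M.frontierLaw` (`(1/4)^{|γ|} · 4^{|γ|} · P[frontier = γ] = P[frontier = γ]`)
  and `tiltedLaw_one_quarter : M.tiltedLaw 1 4⁻¹ = (frontierLaw univ)⁻¹ • frontierLaw` — the law
  of the excursion's right frontier; `frontierWeight_ne_zero_iff : B γ ≠ 0 ↔ γ ∈ range frontier`
  (so "achievability" of the companion request is exactly `B > 0` on all SAWs).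
* **Exact one-sided restriction covariance for every `(s, x)`** (PROVED in the abstract form the
  request states it: "`B_Ω(γ) = B_{D'}(γ)` for `γ ⊆ cl D'` by left-measurability"). For an
  inclusion of discrete domains `h : Ω'_δ ≤ Ω_δ` (`discreteDomainGraph`), `DomainSAW.ofLE h` embeds
  the SAWs of `Ω'_δ` into those of `Ω_δ` (injective, length- and curve-preserving; its range is
  the set of SAWs of `Ω_δ` using only edges of `Ω'_δ`, `DomainSAW.range_ofLE`). If two weights agree
  along the embedding, `B (ofLE h γ') = B' γ'` — for frontier models: the frontier weight of `Ω`
  restricted to SAWs of the subdomain is the frontier weight of the subdomain, which is what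
  left-measurability of the frontier plus the collar identity give for a hull subdomain attached
  to the right boundary arc — then
  `tiltedWeight_restrict_range_ofLE : (W_B^{(s,x)}).restrict (range (ofLE h)) = (ofLE h)_* W_{B'}^{(s,x)}`
  and, for finite mass, `tiltedLaw_cond_range_ofLE : P_B^{(s,x)}[ · | range (ofLE h)] = (ofLE h)_* P_{B'}^{(s,x)}`
  (`ProbabilityTheory.cond`); specialised to models in `FrontierModel.tiltedLaw_cond_range_ofLE`.
  Identifying the event `range (ofLE h)` with `{γ | range γ.curve ⊆ cl Ω'}` is the discretisation
  bookkeeping (largest-component convention of `meshDomain`, `2δ`-collar on `ℤ²`) of the companion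
  request and is NOT asserted here.
* **The critical curve `x(s)`** (`criticalTilt`), domain-independent by construction: for a
  half-plane frontier weight `Bh v p` on the walks `p : 0 → v` of `ℤ²` (to be instantiated with
  the half-plane frontier model) let `tiltedBridgeMass Bh s n = ∑_{bridges p of length n} Bh(p)^s`
  (bridges `SAW.IsBridge` of `SupercriticalSAWPolygons.lean`: `0 < y ≤ y(end)` off the origin,
  Madras–Slade Def. 1.2.4), `tiltedBridgeSeries Bh s x = ∑_n x^n · tiltedBridgeMass Bh s n` (the
  half-plane bridge-type generating function `∑_γ x^{|γ|} B_ℍ(γ)^s`) and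
  `criticalTilt Bh s = x(s) = sup {x ≥ 0 | tiltedBridgeSeries Bh s x < ∞}`. The supremum always
  exists (the series is monotone in `x ≥ 0`, so the set is an initial interval of `[0, ∞)`; junk
  `0` if it is all of `[0, ∞)`); `tiltedBridgeMass_zero : tiltedBridgeMass Bh 0 n = bₙ`
  (`SAW.bridgeCount`), so at `s = 0` the series is the bridge generating function `∑ bₙ xⁿ`
  whatever `Bh` is, and **`x(0) = x_c`** follows from the Hammersley–Welsh bounds
  `e^{-c√n} μⁿ ≤ bₙ ≤ μⁿ` (PROVED in the leaf file `FrontierTiltedSAWCritical.lean`,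
  `criticalTilt_zero`, kept separate so that this file's import cone stays that of
  `SelfAvoidingWalk.lean` + `SupercriticalSAWPolygons.lean`). [cite: MadrasSlade1993, §1.2, Def. 1.2.4 and eq. (1.2.17)]

## What is NOT claimed (open, model-specific, or conjectural — recorded for the route)

* `x(1) = 1/4` (the random-walk value: at `s = 1` the series is `∑_ω (4x)^{|frontier ω|} 4^{-|ω|}`
  over half-plane paths whose frontier is a bridge; finite for `x < 1/4` since
  `|frontier ω| ≥ dist(0, end)`, infinite at `x = 1/4` since the half-plane Green function is not
  summable) — needs the concrete face-walk model and random-walk estimates;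
* that `x(s)` so defined is the critical fugacity of the finite-domain families `P^{(s,x)}_{Ω,δ}`
  for `0 < s < 1` (super-multiplicativity of `tiltedBridgeMass Bh s ·` by concatenation of
  bridges, `B` factorising up to boundary terms by left-measurability, would give
  `x(s) = 1 / lim (tiltedBridgeMass Bh s n)^{1/n}` by Fekete as for `μ_Bridge = μ`,
  Madras–Slade (1.2.15)–(1.2.17); this is part of crux `OneSidedContinuation`, not a definition);
* positivity `B > 0` on all SAWs (= surjectivity of `frontier`, the "achievability" lemma of
  `RightFrontierSAW`) and finiteness of `B` (finiteness of killed Green functions) — properties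
  of the concrete model; here they appear only as the iff `frontierWeight_ne_zero_iff` and as the
  finite-mass hypothesis of `tiltedLaw_cond_range_ofLE`.

No named facts (`def … : Prop`) are introduced; everything stated is proved.
-/

noncomputable section

open MeasureTheory Filter Topology Literature.Probability.LatticeModels
  Literature.Probability.Percolation
open scoped NNReal ENNReal

namespace Literature.Probability.RandomPlanarGeometry.SAW

variable {Ω Ω' : Set ℂ} {δ : ℝ} {a b : Site 2}

/-! ### Preliminaries: SAWs of a subdomain -/

namespace DomainSAW

/-- Every set of SAWs is measurable (the σ-algebra on `DomainSAW Ω δ a b` is `⊤`). [folklore] -/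
instance : DiscreteMeasurableSpace (DomainSAW Ω δ a b) :=
  ⟨fun _ => MeasurableSpace.measurableSet_top⟩

/-- A SAW is determined by its underlying lattice walk. [folklore] -/
theorem walk_injective :
    Function.Injective (DomainSAW.walk : DomainSAW Ω δ a b → (discreteDomainGraph Ω δ).Walk a b) := by
  rintro ⟨w, hw⟩ ⟨w', hw'⟩ (h : w = w')
  subst h
  rfl

/-- SAWs of a discrete subdomain are SAWs of the domain: transport along an inclusion of graphs
`Ω'_δ ≤ Ω_δ` (`SimpleGraph.Walk.mapLe`; self-avoidance is preserved). [folklore] -/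
def ofLE (h : discreteDomainGraph Ω' δ ≤ discreteDomainGraph Ω δ) (γ : DomainSAW Ω' δ a b) :
    DomainSAW Ω δ a b :=
  ⟨γ.walk.mapLe h, γ.isPath.mapLe h⟩

/-- The underlying walk of the transported SAW. [folklore] -/
@[simp] theorem walk_ofLE (h : discreteDomainGraph Ω' δ ≤ discreteDomainGraph Ω δ)
    (γ : DomainSAW Ω' δ a b) : (ofLE h γ).walk = γ.walk.mapLe h := rfl

/-- Transport preserves the length. [folklore] -/
@[simp] theorem length_ofLE (h : discreteDomainGraph Ω' δ ≤ discreteDomainGraph Ω δ)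
    (γ : DomainSAW Ω' δ a b) : (ofLE h γ).length = γ.length :=
  SimpleGraph.Walk.length_map _ _

/-- Transport preserves the traced curve (the polyline only depends on the support).
[folklore] -/
@[simp] theorem curve_ofLE (h : discreteDomainGraph Ω' δ ≤ discreteDomainGraph Ω δ)
    (γ : DomainSAW Ω' δ a b) : (ofLE h γ).curve = γ.curve := by
  simp only [DomainSAW.curve, ofLE, SimpleGraph.Walk.toCurve,
    SimpleGraph.Walk.support_mapLe_eq_support]

/-- Transport of SAWs along an inclusion of discrete domains is injective. [folklore] -/
theorem ofLE_injective (h : discreteDomainGraph Ω' δ ≤ discreteDomainGraph Ω δ) :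
    Function.Injective (ofLE (a := a) (b := b) h) := by
  intro γ γ' hγ
  apply walk_injective
  have hw : γ.walk.mapLe h = γ'.walk.mapLe h := congrArg DomainSAW.walk hγ
  exact SimpleGraph.Walk.map_injective_of_injective (f := SimpleGraph.Hom.ofLE h)
    (fun _ _ e => e) a b hw

/-- The SAWs of `Ω_δ` coming from the subdomain `Ω'_δ` are exactly those all of whose edges are
edges of `Ω'_δ` (`SimpleGraph.Walk.transfer`). [folklore] -/
theorem range_ofLE (h : discreteDomainGraph Ω' δ ≤ discreteDomainGraph Ω δ) :
    Set.range (ofLE (a := a) (b := b) h) =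
      {γ | ∀ e ∈ γ.walk.edges, e ∈ (discreteDomainGraph Ω' δ).edgeSet} := by
  ext γ
  constructor
  · rintro ⟨γ', rfl⟩ e he
    rw [walk_ofLE, SimpleGraph.Walk.edges_mapLe_eq_edges] at he
    exact γ'.walk.edges_subset_edgeSet he
  · intro hγ
    refine ⟨⟨γ.walk.transfer _ hγ, γ.isPath.transfer hγ⟩, ?_⟩
    apply walk_injective
    change (γ.walk.transfer _ hγ).map (.ofLE h) = γ.walk
    have hp2 : ∀ e ∈ (γ.walk.transfer (discreteDomainGraph Ω' δ) hγ).edges,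
        e ∈ (discreteDomainGraph Ω δ).edgeSet := by
      intro e he
      rw [SimpleGraph.Walk.edges_transfer] at he
      exact γ.walk.edges_subset_edgeSet he
    rw [← SimpleGraph.Walk.transfer_eq_map_ofLE _ hp2 h, SimpleGraph.Walk.transfer_transfer,
      SimpleGraph.Walk.transfer_self]

end DomainSAW

/-! ### The tilted weights `W^{(s,x)}_B(γ) = x^{|γ|} B(γ)^s` and their laws -/

/-- The **tilted SAW weight** `W^{(s,x)}_B`: the SAW `γ` of `Ω_δ` from `a` to `b` gets mass
`x^{|γ|} · B(γ)^s`, where `B` is a weight on SAWs (the frontier weight of a `FrontierModel`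
below), `x` a fugacity and `s ∈ [0, 1]` the tilt exponent (`ENNReal.rpow`, so `B^0 = 1` even for
`B ∈ {0, ∞}`). A sum of weighted Dirac masses, as `SAW.weight`. New object of route
SAWFrontierHomotopy (card drain-the-lakes-one-sided-homotopy); the two-sided analogue is the
`λ`-SAW. [cite: KozdronLawler2007, §6] -/
def tiltedWeight (B : DomainSAW Ω δ a b → ℝ≥0∞) (s x : ℝ) : Measure (DomainSAW Ω δ a b) :=
  Measure.sum fun γ => (ENNReal.ofReal (x ^ γ.length) * B γ ^ s) • Measure.dirac γ

/-- The **tilted SAW law** `P^{(s,x)}_B = W^{(s,x)}_B / W^{(s,x)}_B(univ)`; junk value `0` when the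
total mass is `0` or `∞` (as for `SAW.law`). [cite: KozdronLawler2007, §6] -/
def tiltedLaw (B : DomainSAW Ω δ a b → ℝ≥0∞) (s x : ℝ) : Measure (DomainSAW Ω δ a b) :=
  (tiltedWeight B s x Set.univ)⁻¹ • tiltedWeight B s x

/-- The tilted weight of a set of SAWs is the sum of the weights of its members. [folklore] -/
theorem tiltedWeight_apply (B : DomainSAW Ω δ a b → ℝ≥0∞) (s x : ℝ)
    (S : Set (DomainSAW Ω δ a b)) :
    tiltedWeight B s x S =
      ∑' γ, S.indicator (fun γ => ENNReal.ofReal (x ^ γ.length) * B γ ^ s) γ := by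
  rw [tiltedWeight, Measure.sum_apply _ (MeasurableSpace.measurableSet_top)]
  refine tsum_congr fun γ => ?_
  by_cases hγ : γ ∈ S
  · simp [hγ]
  · simp [hγ]

/-- The tilted weight of a single SAW is `x^{|γ|} B(γ)^s`. [folklore] -/
theorem tiltedWeight_singleton (B : DomainSAW Ω δ a b → ℝ≥0∞) (s x : ℝ) (γ : DomainSAW Ω δ a b) :
    tiltedWeight B s x {γ} = ENNReal.ofReal (x ^ γ.length) * B γ ^ s := by
  rw [tiltedWeight_apply, tsum_eq_single γ]
  · simp
  · intro γ' hγ'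
    simp [hγ']

/-- At `s = 0` the tilt disappears: `W^{(0,x)}(γ) = x^{|γ|}` for EVERY weight `B`
(`B^0 = 1` in `ℝ≥0∞`, including `0^0 = ∞^0 = 1`). [folklore] -/
theorem tiltedWeight_zero_left (B : DomainSAW Ω δ a b → ℝ≥0∞) (x : ℝ) :
    tiltedWeight B 0 x = Measure.sum fun γ => ENNReal.ofReal (x ^ γ.length) • Measure.dirac γ := by
  simp [tiltedWeight, ENNReal.rpow_zero]

/-- **`W^{(0, x_c)}` is the critical SAW measure `SAW.weight`** (`x_c^{|γ|} = μ^{-|γ|}`), for every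
weight `B`: the `s = 0` end of the homotopy. [folklore] -/
theorem tiltedWeight_zero_criticalFugacity (B : DomainSAW Ω δ a b → ℝ≥0∞) :
    tiltedWeight B 0 criticalFugacity = weight Ω δ a b := by
  rw [tiltedWeight_zero_left]
  rfl

/-- **`P^{(0, x_c)}` is the critical SAW law `SAW.law`**, for every weight `B`. [folklore] -/
theorem tiltedLaw_zero_criticalFugacity (B : DomainSAW Ω δ a b → ℝ≥0∞) :
    tiltedLaw B 0 criticalFugacity = law Ω δ a b := by
  rw [tiltedLaw, tiltedWeight_zero_criticalFugacity]
  rfl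

/-- The tilted law is either the junk value `0` (total weight `0` or `∞`) or a probability
measure. [folklore] -/
theorem tiltedLaw_eq_zero_or_isProbabilityMeasure (B : DomainSAW Ω δ a b → ℝ≥0∞) (s x : ℝ) :
    tiltedLaw B s x = 0 ∨ IsProbabilityMeasure (tiltedLaw B s x) := by
  by_cases h0 : tiltedWeight B s x Set.univ = 0
  · left
    rw [tiltedLaw, Measure.measure_univ_eq_zero.mp h0, smul_zero]
  by_cases htop : tiltedWeight B s x Set.univ = ⊤
  · left
    rw [tiltedLaw, htop, ENNReal.inv_top, zero_smul]
  · right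
    refine ⟨?_⟩
    rw [tiltedLaw, Measure.smul_apply, smul_eq_mul, ENNReal.inv_mul_cancel h0 htop]

/-! ### Exact restriction covariance of tilted weights (abstract form) -/

/-- **Restriction covariance of the tilted weights.** If the weight `B` on the SAWs of `Ω_δ`
restricts along `Ω'_δ ≤ Ω_δ` to the weight `B'` on the SAWs of `Ω'_δ`, then for every `(s, x)`
the tilted weight of `Ω` restricted to the SAWs of the subdomain is the push-forward of the tilted
weight of the subdomain. For frontier weights the hypothesis is the left-measurability of the
frontier (plus the collar identity) for hull subdomains attached to the right arc; at `s = 0` it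
is vacuous and this is the lattice restriction property of the `x`-SAW. [folklore] -/
theorem tiltedWeight_restrict_range_ofLE (h : discreteDomainGraph Ω' δ ≤ discreteDomainGraph Ω δ)
    {B : DomainSAW Ω δ a b → ℝ≥0∞} {B' : DomainSAW Ω' δ a b → ℝ≥0∞}
    (hB : ∀ γ', B (DomainSAW.ofLE h γ') = B' γ') (s x : ℝ) :
    (tiltedWeight B s x).restrict (Set.range (DomainSAW.ofLE h)) =
      (tiltedWeight B' s x).map (DomainSAW.ofLE h) := by
  ext S hS
  rw [Measure.restrict_apply hS, tiltedWeight_apply,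
    Measure.map_apply (DomainSAW.measurable_of_top _) hS, tiltedWeight_apply]
  have key : ∀ γ', (DomainSAW.ofLE h ⁻¹' S).indicator
      (fun γ' => ENNReal.ofReal (x ^ γ'.length) * B' γ' ^ s) γ' =
      (S ∩ Set.range (DomainSAW.ofLE h)).indicator
        (fun γ => ENNReal.ofReal (x ^ γ.length) * B γ ^ s) (DomainSAW.ofLE h γ') := by
    intro γ'
    by_cases hγ' : DomainSAW.ofLE h γ' ∈ S
    · rw [Set.indicator_of_mem (show γ' ∈ DomainSAW.ofLE h ⁻¹' S from hγ'),
        Set.indicator_of_mem (show DomainSAW.ofLE h γ' ∈ S ∩ Set.range (DomainSAW.ofLE h) from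
          ⟨hγ', Set.mem_range_self γ'⟩), DomainSAW.length_ofLE, hB]
    · rw [Set.indicator_of_notMem (show γ' ∉ DomainSAW.ofLE h ⁻¹' S from hγ'),
        Set.indicator_of_notMem (fun hh => hγ' hh.1)]
  rw [tsum_congr key]
  symm
  exact (DomainSAW.ofLE_injective h).tsum_eq fun γ hγ =>
    (Set.support_indicator_subset hγ).2

/-- **Restriction covariance of the tilted laws** (`P^{(s,x)}_Ω[ · | γ is a SAW of Ω'_δ] =
P^{(s,x)}_{Ω'}` transported), for every `(s, x)`, under the hypothesis of
`tiltedWeight_restrict_range_ofLE` and finiteness of the total weight (automatic for bounded `Ω`,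
`δ > 0` and finite `B`). [folklore] -/
theorem tiltedLaw_cond_range_ofLE (h : discreteDomainGraph Ω' δ ≤ discreteDomainGraph Ω δ)
    {B : DomainSAW Ω δ a b → ℝ≥0∞} {B' : DomainSAW Ω' δ a b → ℝ≥0∞}
    (hB : ∀ γ', B (DomainSAW.ofLE h γ') = B' γ') (s x : ℝ)
    (hfin : tiltedWeight B s x Set.univ ≠ ⊤) :
    ProbabilityTheory.cond (tiltedLaw B s x) (Set.range (DomainSAW.ofLE h)) =
      (tiltedLaw B' s x).map (DomainSAW.ofLE h) := by
  have hcov := tiltedWeight_restrict_range_ofLE h hB s x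
  set Z := tiltedWeight B s x Set.univ with hZ
  set E := Set.range (DomainSAW.ofLE (a := a) (b := b) h) with hE
  have hE' : tiltedWeight B' s x Set.univ = tiltedWeight B s x E := by
    have h1 := congrArg (fun μ : Measure (DomainSAW Ω δ a b) => μ Set.univ) hcov
    simp only [Measure.restrict_apply MeasurableSet.univ, Set.univ_inter,
      Measure.map_apply (DomainSAW.measurable_of_top _) MeasurableSet.univ,
      Set.preimage_univ] at h1
    exact h1.symm
  have hscal : (Z⁻¹ * tiltedWeight B s x E)⁻¹ * Z⁻¹ = (tiltedWeight B s x E)⁻¹ := by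
    have hle : tiltedWeight B s x E ≤ Z := measure_mono (Set.subset_univ _)
    by_cases hZ0 : Z = 0
    · have hWE : tiltedWeight B s x E = 0 := nonpos_iff_eq_zero.mp (hZ0 ▸ hle)
      simp [hZ0, hWE]
    · rw [ENNReal.mul_inv (Or.inl (ENNReal.inv_ne_zero.mpr hfin))
          (Or.inl (ENNReal.inv_ne_top.mpr hZ0)), inv_inv, mul_comm Z, mul_assoc,
        ENNReal.mul_inv_cancel hZ0 hfin, mul_one]
  rw [ProbabilityTheory.cond, tiltedLaw, tiltedLaw, Measure.map_smul, ← hcov, Measure.smul_apply,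
    Measure.restrict_smul, smul_smul, smul_eq_mul, hscal, hE']

/-! ### Frontier models: the random-walk excursion frontier and its weight `B` -/

/-- A **frontier model** for `(Ω_δ; a, b)`: a type of lattice paths `ω` (intended: the
nearest-neighbour walks on the closed faces of `Ω_δ` from the face at `a` to the face at `b`),
their length `len ω = |ω|`, and a frontier map `ω ↦ frontier ω`, a self-avoiding walk of `Ω_δ`
from `a` to `b` (intended: the right frontier of the checkerboard-pinch-filled union of the faces
visited, notion `RightFrontierSAW`). Each path carries the simple-random-walk weight `4^{-|ω|}`.
The continuum counterpart is the right boundary of the Brownian excursion, an SLE(8/3, 2/3)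
[cite: LawlerSchrammWerner2003Restriction, §8.1 and Cor. 8.5]. -/
structure FrontierModel (Ω : Set ℂ) (δ : ℝ) (a b : Site 2) where
  /-- the lattice paths (face-walks of `Ω_δ` from the face at `a` to the face at `b`) -/
  Path : Type
  /-- the number of steps of a path -/
  len : Path → ℕ
  /-- the (right) frontier of a path, a SAW of `Ω_δ` from `a` to `b` -/
  frontier : Path → DomainSAW Ω δ a b

namespace FrontierModel

variable (M : FrontierModel Ω δ a b)

/-- The simple-random-walk weight `4^{-|ω|}` of a path. [cite: KozdronLawler2007, §6] -/
def pathWeight (ω : M.Path) : ℝ≥0∞ :=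
  (4 : ℝ≥0∞)⁻¹ ^ M.len ω

/-- The **frontier measure**: the push-forward of the random-walk path measure `∑_ω 4^{-|ω|} δ_ω`
under the frontier map — the un-normalised law of the right frontier of the random-walk excursion
from `a` to `b` in `Ω_δ`; its total mass is the excursion mass. [folklore] -/
def frontierLaw : Measure (DomainSAW Ω δ a b) :=
  Measure.sum fun ω => M.pathWeight ω • Measure.dirac (M.frontier ω)

/-- The **frontier weight** `B(γ) = 4^{|γ|} · ∑_{frontier ω = γ} 4^{-|ω|}` of a SAW `γ`.
[folklore] -/
def frontierWeight (γ : DomainSAW Ω δ a b) : ℝ≥0∞ :=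
  4 ^ γ.length * M.frontierLaw {γ}

/-- The tilted family `W^{(s,x)}(γ) = x^{|γ|} B(γ)^s` of the model. [cite: KozdronLawler2007, §6] -/
protected def tiltedWeight (s x : ℝ) : Measure (DomainSAW Ω δ a b) :=
  SAW.tiltedWeight M.frontierWeight s x

/-- The normalised tilted family `P^{(s,x)} ∝ x^{|γ|} B(γ)^s` of the model — the
**frontier-tilted SAW law**. [cite: KozdronLawler2007, §6] -/
protected def tiltedLaw (s x : ℝ) : Measure (DomainSAW Ω δ a b) :=
  SAW.tiltedLaw M.frontierWeight s x

/-- The path weight is never `0`. [folklore] -/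
theorem pathWeight_ne_zero (ω : M.Path) : M.pathWeight ω ≠ 0 :=
  pow_ne_zero _ (ENNReal.inv_ne_zero.mpr (ENNReal.ofNat_ne_top))

/-- The frontier measure of a set of SAWs is the random-walk mass of the paths whose frontier
lies in it. [folklore] -/
theorem frontierLaw_apply (S : Set (DomainSAW Ω δ a b)) :
    M.frontierLaw S = ∑' ω, (M.frontier ⁻¹' S).indicator M.pathWeight ω := by
  rw [frontierLaw, Measure.sum_apply _ (MeasurableSpace.measurableSet_top)]
  refine tsum_congr fun ω => ?_
  by_cases hω : M.frontier ω ∈ S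
  · rw [Set.indicator_of_mem (show ω ∈ M.frontier ⁻¹' S from hω)]
    simp [hω]
  · rw [Set.indicator_of_notMem (show ω ∉ M.frontier ⁻¹' S from hω)]
    simp [hω]

/-- `B(γ) = 4^{|γ|} ∑_{ω : frontier ω = γ} 4^{-|ω|}`, the formula of the request. [folklore] -/
theorem frontierWeight_eq (γ : DomainSAW Ω δ a b) :
    M.frontierWeight γ = 4 ^ γ.length * ∑' ω, (M.frontier ⁻¹' {γ}).indicator M.pathWeight ω := by
  rw [frontierWeight, frontierLaw_apply]

/-- **`B(γ) ≠ 0` iff `γ` is the frontier of some path** (so `B > 0` on all SAWs is exactly the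
surjectivity of the frontier map, the "achievability" of the companion request). [folklore] -/
theorem frontierWeight_ne_zero_iff (γ : DomainSAW Ω δ a b) :
    M.frontierWeight γ ≠ 0 ↔ γ ∈ Set.range M.frontier := by
  rw [frontierWeight_eq, mul_ne_zero_iff]
  have h4 : (4 : ℝ≥0∞) ^ γ.length ≠ 0 := pow_ne_zero _ (by norm_num)
  rw [and_iff_right h4, Ne, ENNReal.tsum_eq_zero, not_forall]
  constructor
  · rintro ⟨ω, hω⟩
    refine ⟨ω, ?_⟩
    by_contra hne
    exact hω (Set.indicator_of_notMem (show ω ∉ M.frontier ⁻¹' {γ} from hne) _)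
  · rintro ⟨ω, rfl⟩
    refine ⟨ω, ?_⟩
    rw [Set.indicator_of_mem (show ω ∈ M.frontier ⁻¹' {M.frontier ω} from rfl)]
    exact M.pathWeight_ne_zero ω

/-- The coefficient identity behind `s = 1`, `x = 1/4`:
`(1/4)^{|γ|} · (4^{|γ|} L)^1 = L`. [folklore] -/
theorem quarter_pow_mul_frontierWeight (γ : DomainSAW Ω δ a b) :
    ENNReal.ofReal ((4 : ℝ)⁻¹ ^ γ.length) * M.frontierWeight γ ^ (1 : ℝ) = M.frontierLaw {γ} := by
  rw [ENNReal.rpow_one, frontierWeight, ← mul_assoc, ENNReal.ofReal_pow (by norm_num),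
    ENNReal.ofReal_inv_of_pos (by norm_num), ENNReal.ofReal_ofNat, ← mul_pow,
    ENNReal.inv_mul_cancel (by norm_num) (ENNReal.ofNat_ne_top), one_pow, one_mul]

/-- **At `s = 1`, `x = 1/4` the tilted weight IS the frontier measure of the random-walk
excursion**: `W^{(1,1/4)}(γ) = (1/4)^{|γ|} B(γ) = ∑_{frontier ω = γ} 4^{-|ω|}`. [folklore] -/
theorem tiltedWeight_one_quarter : M.tiltedWeight 1 4⁻¹ = M.frontierLaw := by
  classical
  ext S hS
  rw [FrontierModel.tiltedWeight, tiltedWeight_apply, frontierLaw_apply]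
  have hcoef : ∀ γ, S.indicator (fun γ => ENNReal.ofReal ((4 : ℝ)⁻¹ ^ γ.length) *
      M.frontierWeight γ ^ (1 : ℝ)) γ = S.indicator (fun γ => M.frontierLaw {γ}) γ := by
    intro γ
    by_cases hγ : γ ∈ S
    · rw [Set.indicator_of_mem hγ, Set.indicator_of_mem hγ, quarter_pow_mul_frontierWeight]
    · rw [Set.indicator_of_notMem hγ, Set.indicator_of_notMem hγ]
  simp_rw [hcoef]
  have hinner : ∀ γ, S.indicator (fun γ => M.frontierLaw {γ}) γ =
      ∑' ω, if M.frontier ω = γ then (M.frontier ⁻¹' S).indicator M.pathWeight ω else 0 := by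
    intro γ
    by_cases hγ : γ ∈ S
    · rw [Set.indicator_of_mem hγ, frontierLaw_apply]
      refine tsum_congr fun ω => ?_
      by_cases hω : M.frontier ω = γ
      · rw [if_pos hω, Set.indicator_of_mem (show ω ∈ M.frontier ⁻¹' {γ} from hω),
          Set.indicator_of_mem (show ω ∈ M.frontier ⁻¹' S by rw [Set.mem_preimage, hω]; exact hγ)]
      · rw [if_neg hω, Set.indicator_of_notMem (show ω ∉ M.frontier ⁻¹' {γ} from hω)]
    · rw [Set.indicator_of_notMem hγ]
      symm
      refine ENNReal.tsum_eq_zero.mpr fun ω => ?_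
      by_cases hω : M.frontier ω = γ
      · rw [if_pos hω, Set.indicator_of_notMem]
        rw [Set.mem_preimage, hω]
        exact hγ
      · rw [if_neg hω]
  simp_rw [hinner]
  rw [ENNReal.tsum_comm]
  refine tsum_congr fun ω => ?_
  exact tsum_ite_eq' (M.frontier ω) fun _ => (M.frontier ⁻¹' S).indicator M.pathWeight ω

/-- **At `s = 1`, `x = 1/4` the tilted law is the law of the right frontier of the random-walk
excursion** (the frontier measure normalised by the excursion mass). [folklore] -/
theorem tiltedLaw_one_quarter :
    M.tiltedLaw 1 4⁻¹ = (M.frontierLaw Set.univ)⁻¹ • M.frontierLaw := by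
  rw [FrontierModel.tiltedLaw, tiltedLaw, ← FrontierModel.tiltedWeight, tiltedWeight_one_quarter]

/-- **At `s = 0`, `x = x_c` the tilted law of any frontier model is the critical SAW law.**
[folklore] -/
theorem tiltedLaw_zero_criticalFugacity : M.tiltedLaw 0 criticalFugacity = law Ω δ a b :=
  SAW.tiltedLaw_zero_criticalFugacity _

/-- **One-sided restriction covariance of the frontier-tilted laws, for every `(s, x)`.** Let
`Ω'_δ ≤ Ω_δ` and let `M`, `M'` be frontier models of `Ω`, `Ω'` whose frontier weights agree on
the SAWs of the subdomain, `B_Ω(γ) = B_{Ω'}(γ)` — for the right-frontier models and a hull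
subdomain attached to the right boundary arc this is left-measurability of the frontier (the
paths with frontier `γ` and their weights only involve the region left of `γ`). Then
`P^{(s,x)}_Ω[ · | γ is a SAW of Ω'_δ]` is `P^{(s,x)}_{Ω'}` transported, whenever the total
tilted weight is finite. [folklore] -/
theorem tiltedLaw_cond_range_ofLE (h : discreteDomainGraph Ω' δ ≤ discreteDomainGraph Ω δ)
    (M : FrontierModel Ω δ a b) (M' : FrontierModel Ω' δ a b)
    (hB : ∀ γ', M.frontierWeight (DomainSAW.ofLE h γ') = M'.frontierWeight γ') (s x : ℝ)
    (hfin : M.tiltedWeight s x Set.univ ≠ ⊤) :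
    ProbabilityTheory.cond (M.tiltedLaw s x) (Set.range (DomainSAW.ofLE h)) =
      (M'.tiltedLaw s x).map (DomainSAW.ofLE h) :=
  SAW.tiltedLaw_cond_range_ofLE h hB s x hfin

end FrontierModel

/-! ### The critical curve `x(s)` via the half-plane bridge-type generating function -/

open Classical in
/-- The **tilted bridge mass** at length `n`: `∑_{p bridge, |p| = n} Bh(p)^s`, over the bridges
`p : 0 → v` of `ℤ²` (`SAW.IsBridge`: self-avoiding, `0 < y ≤ y(v)` off the origin; endpoints in
the box `{-n,…,n}²`, which contains all of them, exactly as in `SAW.bridgeCount`), for a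
half-plane weight `Bh` (intended: the half-plane frontier weight
`B_ℍ(p) = 4^{|p|} ∑_{frontier ω = p} 4^{-|ω|}` of the right-frontier model). At `s = 0` this is
`bₙ` (`tiltedBridgeMass_zero`). [cite: MadrasSlade1993, §1.2, Definition 1.2.4] -/
def tiltedBridgeMass (Bh : ∀ v : Site 2, (zdGraph 2).Walk (0 : Site 2) v → ℝ≥0∞) (s : ℝ)
    (n : ℕ) : ℝ≥0∞ :=
  ∑ v ∈ box 2 n, ∑ p ∈ ((zdGraph 2).finsetWalkLength n (0 : Site 2) v).filter
    (fun p => IsBridge p), Bh v p ^ s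

/-- The **half-plane bridge-type generating function** `Z(s, x) = ∑_n x^n · tiltedBridgeMass s n
= ∑_{bridges γ} x^{|γ|} B_ℍ(γ)^s` (in `ℝ≥0∞`, possibly `∞`). [cite: MadrasSlade1993, §1.2, eq. (1.2.17)] -/
def tiltedBridgeSeries (Bh : ∀ v : Site 2, (zdGraph 2).Walk (0 : Site 2) v → ℝ≥0∞) (s x : ℝ) :
    ℝ≥0∞ :=
  ∑' n : ℕ, ENNReal.ofReal (x ^ n) * tiltedBridgeMass Bh s n

/-- The **critical curve** `x(s) = sup {x ≥ 0 | Z(s, x) < ∞}`: the radius of finiteness of the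
half-plane bridge-type generating function of the tilted weights — domain-independent by
construction (defined from half-plane data only), in the manner of the critical `r_λ` of the
`λ`-SAW ("the total mass neither decays nor grows exponentially") and of `μ_Bridge = μ`. The set is
a non-empty initial interval of `[0, ∞)` (the series is monotone in `x ≥ 0` and equals
`tiltedBridgeMass Bh s 0 < ∞` at `x = 0` as soon as `Bh(nil)^s < ∞`); junk value `0` if it is
unbounded. Sanity values: `x(0) = x_c` (PROVED, `criticalTilt_zero` in
`FrontierTiltedSAWCritical.lean`); `x(1) = 1/4` for the random-walk frontier model (expected, not
proved here). [cite: KozdronLawler2007, §6] -/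
def criticalTilt (Bh : ∀ v : Site 2, (zdGraph 2).Walk (0 : Site 2) v → ℝ≥0∞) (s : ℝ) : ℝ :=
  sSup {x : ℝ | 0 ≤ x ∧ tiltedBridgeSeries Bh s x ≠ ⊤}

/-- At `s = 0` the tilted bridge mass is the number of bridges `bₙ`, whatever the weight.
[cite: MadrasSlade1993, §1.2, Definition 1.2.4] -/
theorem tiltedBridgeMass_zero (Bh : ∀ v : Site 2, (zdGraph 2).Walk (0 : Site 2) v → ℝ≥0∞)
    (n : ℕ) : tiltedBridgeMass Bh 0 n = bridgeCount n := by
  classical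
  unfold tiltedBridgeMass bridgeCount
  push_cast
  refine Finset.sum_congr rfl fun v _ => ?_
  simp [ENNReal.rpow_zero]

/-- At `s = 0` the generating function is the bridge generating function `∑ₙ bₙ xⁿ`, whatever the
weight. [cite: MadrasSlade1993, §1.2, eq. (1.2.17)] -/
theorem tiltedBridgeSeries_zero (Bh : ∀ v : Site 2, (zdGraph 2).Walk (0 : Site 2) v → ℝ≥0∞)
    (x : ℝ) : tiltedBridgeSeries Bh 0 x = ∑' n : ℕ, ENNReal.ofReal (x ^ n) * bridgeCount n := by
  simp_rw [tiltedBridgeSeries, tiltedBridgeMass_zero]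

/-- Hence the critical curve at `s = 0` does not depend on the weight: it is the radius of
finiteness of the bridge generating function. [cite: MadrasSlade1993, §1.2, eq. (1.2.17)] -/
theorem criticalTilt_zero_eq (Bh : ∀ v : Site 2, (zdGraph 2).Walk (0 : Site 2) v → ℝ≥0∞) :
    criticalTilt Bh 0 =
      sSup {x : ℝ | 0 ≤ x ∧ (∑' n : ℕ, ENNReal.ofReal (x ^ n) * (bridgeCount n : ℝ≥0∞)) ≠ ⊤} := by
  simp_rw [criticalTilt, tiltedBridgeSeries_zero]

end Literature.Probability.RandomPlanarGeometry.SAW
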